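import Mathlib
import Summits.ResolutionOfSingularities.ResolutionOfSingularities.Theorems.WeightedInvariantDatumToEmbeddedAtlasAmbientChart
import Summits.ResolutionOfSingularities.ResolutionOfSingularities.Theorems.WeightedInvariantDatumToEmbeddedStrictTransform
import Summits.ResolutionOfSingularities.ResolutionOfSingularities.Theorems.WeightedInvariantWeightedThesisGlobalCobordantPlus
import Summits.ResolutionOfSingularities.ResolutionOfSingularities.Theorems.WeightedInvariantRegularSubschemeCentre
import Summits.ResolutionOfSingularities.ResolutionOfSingularities.Theorems.WeightedInvariantLaurentKrullDimension
import Summits.ResolutionOfSingularities.ResolutionOfSingularities.Theorems.WeightedInvariantLaurentKrullDimensionLe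
import Literature.AlgebraicGeometry.Resolution.AlterationsDimension
import HarnessLib

/-!
# (D0) The strict transform of an integral `X` on the global cobordant blow-up has dimension `dim X + 1`

Route `ResolutionOfSingularities/WeightedInvariant`, door `Theses.WeightedInvariant.HypersurfaceCentreConstruction`
(stmt-ResolutionOfSingularities-19897), e-ladder `e = 1`, stub `stub_e1_inv_succ`, piece **(D0)** (res-type-017 RESHAPE
2026-08-27T07:52Z (I0′); res-L1-w43-plan-1 DEALS gen 9 #6 → res-type-076). [OURS · L1 W4.3] Def-free helper
`--supports stmt-ResolutionOfSingularities-19897 --as helper`; nothing here is a claim about Hironaka's problem; AI-written,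
weaker than expert review.

For a closed immersion `i : X ⟶ Y` of an INTEGRAL `X` into `Y` locally of finite type over a field `k`, a Rees filtration
`R'` on `Y` whose full cobordant blow-up `π : B = Spec_Y ⊕ₙ 𝒥ₙ tⁿ ⟶ Y` is locally of finite type (e.g. the filtration of a
regular weighted centre, `WeightedThesis.GlobalCobordantPlus.locallyOfFiniteType_π`), and an affine open `W ∋ i(ξ_X)` on which
some positive piece is the unit ideal (i.e. `W` misses the support of the centre), IF the strict transform
`X' = V(σˢ(ker i)|_{B₊}) ⊆ B₊` is integral then **`dim X' = dim X + 1`**: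

* over `W` every piece is `⊤`, so `Γ(B, π⁻¹W) = Γ(Y, W)[T;T⁻¹]` and `v₀ = T` is a unit in the irrelevant ideal; the chart
  `D(v₀)` of `DatumToEmbedded.AtlasAmbient.exists_chart` is an affine open `W' ⊆ B₊` over `W` with
  `Γ(B₊, W') ≅ L = Γ(Y, W)[T;T⁻¹]`, on which the strict transform is `(ker i)(W) · L` (`t⁻¹` is a unit, the saturation is
  trivial); hence `Γ(X', X' ∩ W') ≅ L ⧸ (ker i)(W)L ≅ (Γ(Y, W) ⧸ (ker i)(W))[T;T⁻¹] ≅ Γ(X, X ∩ W)[T;T⁻¹]`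
  (`ker_mapRingHom_laurent`);
* `X' ∩ W'` is then a NON-EMPTY affine open of the integral `X'`, `X ∩ W ∋ ξ_X` a non-empty affine open of `X`, so both
  dimensions are the Krull dimensions of these rings (`topologicalKrullDim_eq_ringKrullDim_of_isAffineOpen`, Görtz–Wedhorn
  5.22), and `dim A[T;T⁻¹] = dim A + 1` for Noetherian `A` (`ringKrullDim_laurentPolynomial`, from res-type-017's
  `ringKrullDim_add_le_ringKrullDim_laurent` / `ringKrullDim_laurentPolynomial_le`).

`topologicalKrullDim_strictTransformPlus` is res-type-017's requested signature (generic point of `X` off the support of a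
regular weighted centre `R` with `R'.ideal = R.piece`). [cite: Wlodarczyk2022, 3.3.12] [cite: GortzWedhorn2020, Thm. 5.22 (1)]
-/

noncomputable section

open scoped LaurentPolynomial
open LaurentPolynomial CategoryTheory AlgebraicGeometry TopologicalSpace
open Literature.AlgebraicGeometry.Resolution
open Summit.ResolutionOfSingularities.ResolutionOfSingularities.Theorems

set_option linter.dupNamespace false -- mandated namespace of this single-conjunct summit
-- glued scheme `R'.cobordantBlowup` / `Γ(Y, U)` versus `Y.presheaf.obj (op U)` in instance problems (as in the
-- `…DatumToEmbedded.AtlasAmbient` chart file):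
set_option backward.isDefEq.respectTransparency false

namespace Summit.ResolutionOfSingularities.ResolutionOfSingularities.Theorems.StrictTransformDimension

/-! ## §1 Algebra: Laurent polynomial rings -/

section Algebra

variable (A : Type*) [CommRing A]

/-- `dim A[T;T⁻¹] = dim A + 1` for a Noetherian ring `A`. [folklore] -/
theorem ringKrullDim_laurentPolynomial [IsNoetherianRing A] :
    ringKrullDim A[T;T⁻¹] = ringKrullDim A + 1 := by
  refine le_antisymm (ringKrullDim_laurentPolynomial_le A) ?_
  have h := ringKrullDim_add_le_ringKrullDim_laurent A 1
  have e : AddMonoidAlgebra A (Fin 1 → ℤ) ≃+* A[T;T⁻¹] :=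
    (AddMonoidAlgebra.domCongr A A (AddEquiv.funUnique (Fin 1) ℤ)).toRingEquiv
  rw [ringKrullDim_eq_of_ringEquiv e, Nat.cast_one] at h
  exact h

/-- The kernel of the reduction of coefficients `A[T;T⁻¹] → (A ⧸ K)[T;T⁻¹]` is `K · A[T;T⁻¹]`. [folklore] -/
theorem ker_mapRingHom_laurent (K : Ideal A) :
    RingHom.ker (AddMonoidAlgebra.mapRingHom ℤ (Ideal.Quotient.mk K) : A[T;T⁻¹] →+* (A ⧸ K)[T;T⁻¹]) =
      K.map (C : A →+* A[T;T⁻¹]) := by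
  apply le_antisymm
  · intro p hp
    rw [RingHom.mem_ker] at hp
    have hcoef : ∀ n, p.coeff n ∈ K := fun n => by
      have h := congrArg (fun q : (A ⧸ K)[T;T⁻¹] => q.coeff n) hp
      simp only [AddMonoidAlgebra.coeff_mapRingHom, AddMonoidAlgebra.coeff_zero, Finsupp.coe_zero,
        Pi.zero_apply] at h
      exact Ideal.Quotient.eq_zero_iff_mem.mp h
    rw [← AddMonoidAlgebra.sum_coeff_single p, Finsupp.sum]
    refine Ideal.sum_mem _ fun n _ => ?_
    rw [single_eq_C_mul_T]
    exact Ideal.mul_mem_right _ _ (Ideal.mem_map_of_mem C (hcoef n))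
  · rw [Ideal.map_le_iff_le_comap]
    intro a ha
    rw [Ideal.mem_comap, RingHom.mem_ker, ← single_eq_C, AddMonoidAlgebra.mapRingHom_single,
      Ideal.Quotient.eq_zero_iff_mem.mpr ha, AddMonoidAlgebra.single_zero]

/-- The reduction of coefficients `A[T;T⁻¹] → (A ⧸ K)[T;T⁻¹]` is onto. [folklore] -/
theorem mapRingHom_laurent_surjective (K : Ideal A) :
    Function.Surjective
      (AddMonoidAlgebra.mapRingHom ℤ (Ideal.Quotient.mk K) : A[T;T⁻¹] →+* (A ⧸ K)[T;T⁻¹]) := by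
  rw [AddMonoidAlgebra.coe_mapRingHom]
  exact AddMonoidAlgebra.map_surjective _ Ideal.Quotient.mk_surjective

/-- `A[T;T⁻¹] ⧸ K·A[T;T⁻¹] ≃ (A ⧸ K)[T;T⁻¹]`. [folklore] -/
theorem nonempty_quotient_map_C_ringEquiv_laurent (K : Ideal A) :
    Nonempty ((A[T;T⁻¹] ⧸ K.map (C : A →+* A[T;T⁻¹])) ≃+* (A ⧸ K)[T;T⁻¹]) :=
  ⟨(Ideal.quotEquivOfEq (ker_mapRingHom_laurent A K).symm).trans
    (RingHom.quotientKerEquivOfSurjective (mapRingHom_laurent_surjective A K))⟩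

end Algebra

/-! ## §2 The dimension of the strict transform -/

section Geometry

variable {k : Type} [Field k] {Y X : Scheme.{0}}

/-- If ONE positive piece of a Rees filtration is the unit ideal on an affine open, ALL pieces are. [folklore] -/
theorem ideal_eq_top_of_pos (R' : ReesFiltration Y) (W : Y.affineOpens) {n : ℕ} (hn : 0 < n)
    (hW : (R'.ideal n).ideal W = ⊤) (m : ℕ) : (R'.ideal m).ideal W = ⊤ := by
  have hF : ∀ q : ℕ, (R'.filtration W).ideal (q * n) = ⊤ := by
    intro q
    induction q with
    | zero => rw [zero_mul]; exact (R'.filtration W).ideal_zero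
    | succ q ih =>
      rw [Nat.succ_mul, eq_top_iff]
      calc (⊤ : Ideal Γ(Y, W)) = (R'.filtration W).ideal (q * n) * (R'.filtration W).ideal n := by
            rw [ih, ReesFiltration.filtration_ideal, hW, Ideal.top_mul]
        _ ≤ (R'.filtration W).ideal (q * n + n) := (R'.filtration W).mul_le _ _
  rw [← ReesFiltration.filtration_ideal, eq_top_iff, ← hF m]
  exact (R'.filtration W).antitone (Nat.le_mul_of_pos_right m hn)

/-- **The chart of the strict transform over an affine open off the centre.** `i : X ⟶ Y` a closed immersion of an
integral `X`, `Y` locally Noetherian, `R'` a Rees filtration with `B` locally Noetherian, `W` an affine open on which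
some positive piece is the unit ideal: there is an affine open `W'` of `B₊` (over `W`) with
`Γ(X', X' ∩ W') ≃ (Γ(Y, W) ⧸ (ker i)(W))[T;T⁻¹]` for the strict transform `X' = V(σˢ(ker i)|_{B₊})` (the chart `D(T)` over
`W`, on which `t⁻¹` is a unit and the saturation is trivial). [cite: Wlodarczyk2022, 3.3.12] -/
theorem exists_affineOpens_ringEquiv_laurent [IsLocallyNoetherian Y] (i : X ⟶ Y) [IsClosedImmersion i] [IsIntegral X]
    (R' : ReesFiltration Y) [IsLocallyNoetherian R'.cobordantBlowup]
    (W : Y.affineOpens) {n : ℕ} (hn : 0 < n) (hW : (R'.ideal n).ideal W = ⊤) :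
    ∃ W' : (R'.plus : Scheme.{0}).affineOpens,
      Nonempty (Γ((R'.strictTransformPlus i.ker).subscheme,
          (R'.strictTransformPlus i.ker).subschemeι ⁻¹ᵁ (W' : (R'.plus : Scheme.{0}).Opens)) ≃+*
        (Γ(Y, W) ⧸ i.ker.ideal W)[T;T⁻¹]) := by
  classical
  -- all pieces are the unit ideal on `W`: the sections ring over `W` is the whole Laurent ring
  have hall : ∀ m, (R'.ideal m).ideal W = ⊤ := ideal_eq_top_of_pos R' W hn hW
  have hS : ∀ p : (Γ(Y, W))[T;T⁻¹], p ∈ R'.sectionsRing W := fun p => by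
    rw [IdealFiltration.mem_extendedRees_iff]
    intro m
    rw [ReesFiltration.filtration_ideal, hall m]
    trivial
  -- the chart `D(T)` of `B₊` over `W`, with coordinate ring `L = Γ(Y, W)[T;T⁻¹]`
  let v₀ : R'.sectionsRing W := ⟨T (n : ℤ), hS _⟩
  have hv₀irr : v₀ ∈ (R'.filtration W).irrelevant := by
    refine Ideal.subset_span ⟨n, 1, hn, ?_, ?_⟩
    · rw [ReesFiltration.filtration_ideal, hW]; trivial
    · show (T (n : ℤ) : (Γ(Y, W))[T;T⁻¹]) = C 1 * T (n : ℤ)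
      rw [map_one, one_mul]
  have hv₀u : IsUnit v₀ := by
    refine isUnit_iff_exists_inv.mpr ⟨⟨T (-(n : ℤ)), hS _⟩, Subtype.ext ?_⟩
    show (T (n : ℤ) * T (-(n : ℤ)) : (Γ(Y, W))[T;T⁻¹]) = 1
    rw [← T_add, add_neg_cancel, T_zero]
  have hbij : Function.Bijective (algebraMap (R'.sectionsRing W) (Γ(Y, W))[T;T⁻¹]) :=
    ⟨fun a b h => Subtype.ext h, fun p => ⟨⟨p, hS p⟩, rfl⟩⟩
  haveI : IsLocalization.Away v₀ (Γ(Y, W))[T;T⁻¹] :=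
    IsLocalization.away_of_isUnit_of_bijective _ hv₀u hbij
  obtain ⟨W', hW', e, -, -, he₃, -⟩ :=
    DatumToEmbedded.AtlasAmbient.exists_chart R' W (Γ(Y, W))[T;T⁻¹] v₀ hv₀irr
  -- on `W'` the strict transform is `K(W) · L` pulled back along `e`
  have hT : IsUnit (algebraMap (R'.sectionsRing W) (Γ(Y, W))[T;T⁻¹]
      ⟨T (-1), (R'.filtration W).T_neg_one_mem_extendedRees⟩) := by
    change IsUnit (T (-1) : (Γ(Y, W))[T;T⁻¹])
    refine isUnit_iff_exists_inv.mpr ⟨T 1, ?_⟩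
    rw [← T_add]
    exact T_zero
  have hφ : (algebraMap (R'.sectionsRing W) (Γ(Y, W))[T;T⁻¹]).comp (algebraMap Γ(Y, W) (R'.sectionsRing W)) =
      (C : Γ(Y, W) →+* (Γ(Y, W))[T;T⁻¹]) := by
    refine RingHom.ext fun a => ?_
    change ((algebraMap Γ(Y, W) (R'.sectionsRing W) a : R'.sectionsRing W) : (Γ(Y, W))[T;T⁻¹]) = C a
    rw [Subalgebra.coe_algebraMap, ← C_eq_algebraMap]
  have htop : ∀ m : ℕ, ((Ideal.span {algebraMap (R'.sectionsRing W) (Γ(Y, W))[T;T⁻¹]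
      ⟨T (-1), (R'.filtration W).T_neg_one_mem_extendedRees⟩} ^ m : Ideal (Γ(Y, W))[T;T⁻¹]) :
        Set (Γ(Y, W))[T;T⁻¹]) = Set.univ := fun m => by
    rw [Ideal.span_singleton_eq_top.mpr hT, Ideal.top_pow]
    rfl
  have hsat : (⨆ m : ℕ, ((i.ker.ideal W).map (C : Γ(Y, W) →+* (Γ(Y, W))[T;T⁻¹])).colon
      ((Ideal.span {algebraMap (R'.sectionsRing W) (Γ(Y, W))[T;T⁻¹]
        ⟨T (-1), (R'.filtration W).T_neg_one_mem_extendedRees⟩} ^ m : Ideal (Γ(Y, W))[T;T⁻¹]) :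
          Set (Γ(Y, W))[T;T⁻¹])) = (i.ker.ideal W).map (C : Γ(Y, W) →+* (Γ(Y, W))[T;T⁻¹]) := by
    refine le_antisymm (iSup_le fun m => ?_) (le_iSup_of_le 0 ?_)
    · rw [htop m, Submodule.colon_univ]
    · rw [htop 0, Submodule.colon_univ]
  have hI'W' : (R'.strictTransformPlus i.ker).ideal W' =
      ((i.ker.ideal W).map (C : Γ(Y, W) →+* (Γ(Y, W))[T;T⁻¹])).comap e.toRingHom := by
    rw [he₃ i.ker, hφ, hsat]
  -- the coordinate ring of `X' ∩ W'`
  have hsurj : Function.Surjective (e : Γ(R'.plus.toScheme, W') →+* (Γ(Y, W))[T;T⁻¹]) := e.surjective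
  have hmap : ((i.ker.ideal W).map (C : Γ(Y, W) →+* (Γ(Y, W))[T;T⁻¹])) =
      ((R'.strictTransformPlus i.ker).ideal W').map (e : Γ(R'.plus.toScheme, W') →+* (Γ(Y, W))[T;T⁻¹]) := by
    rw [hI'W', RingEquiv.toRingHom_eq_coe, Ideal.map_comap_of_surjective _ hsurj]
  obtain ⟨e₃⟩ := nonempty_quotient_map_C_ringEquiv_laurent Γ(Y, W) (i.ker.ideal W)
  exact ⟨W', ⟨((R'.strictTransformPlus i.ker).subschemeObjIso W').commRingCatIsoToRingEquiv.trans
    ((Ideal.quotientEquiv _ _ e hmap).trans e₃)⟩⟩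

/-- **(D0), chart form.** `i : X ⟶ Y` a closed immersion of an integral `X`, `Y` locally of finite type over a field, `R'`
a Rees filtration with `π : B ⟶ Y` locally of finite type, `W` an affine open containing `i(ξ_X)` on which some positive
piece is the unit ideal; if the strict transform `X' ⊆ B₊` is integral then `dim X' = dim X + 1`.
[cite: Wlodarczyk2022, 3.3.12] [cite: GortzWedhorn2020, Thm. 5.22 (1)] -/
theorem topologicalKrullDim_strictTransformPlus_of_ideal_eq_top (f : Y ⟶ Spec (.of k)) [LocallyOfFiniteType f]
    (i : X ⟶ Y) [IsClosedImmersion i] [IsIntegral X] (R' : ReesFiltration Y) [LocallyOfFiniteType R'.π]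
    (W : Y.affineOpens) {n : ℕ} (hn : 0 < n) (hW : (R'.ideal n).ideal W = ⊤)
    (hξ : i (genericPoint X) ∈ (W : Y.Opens)) [IsIntegral (R'.strictTransformPlus i.ker).subscheme] :
    topologicalKrullDim ↥(R'.strictTransformPlus i.ker).subscheme = topologicalKrullDim ↥X + 1 := by
  classical
  haveI : IsLocallyNoetherian Y := LocallyOfFiniteType.isLocallyNoetherian f
  haveI : IsLocallyNoetherian R'.cobordantBlowup := LocallyOfFiniteType.isLocallyNoetherian R'.π
  obtain ⟨W', ⟨eX'⟩⟩ := exists_affineOpens_ringEquiv_laurent i R' W hn hW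
  -- `Γ(Y, W) ⧸ K(W) ≃ Γ(X, X ∩ W)`, a Noetherian domain
  have hξK : i (genericPoint X) ∈ i.ker.support := i.range_subset_ker_support ⟨_, rfl⟩
  haveI hprime : (i.ker.ideal W).IsPrime := DatumToEmbedded.StrictTransform.isPrime_ker_ideal i hξK W hξ
  have hKW : RingHom.ker (i.app W).hom = i.ker.ideal W := (i.ker_apply W).symm
  have e₄ : (Γ(Y, W) ⧸ i.ker.ideal W) ≃+* Γ(X, i ⁻¹ᵁ (W : Y.Opens)) :=
    (Ideal.quotEquivOfEq hKW.symm).trans (RingHom.quotientKerEquivOfSurjective (i.app_surjective W W.2))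
  haveI : Nontrivial (Γ(Y, W) ⧸ i.ker.ideal W) := Ideal.Quotient.nontrivial_iff.mpr hprime.ne_top
  haveI : IsNoetherianRing Γ(Y, W) := IsLocallyNoetherian.component_noetherian W
  haveI : IsNoetherianRing (Γ(Y, W) ⧸ i.ker.ideal W) := inferInstance
  -- dimension of `X` through the non-empty affine open `X ∩ W`
  have hdimX : topologicalKrullDim ↥X = ringKrullDim Γ(X, i ⁻¹ᵁ (W : Y.Opens)) :=
    topologicalKrullDim_eq_ringKrullDim_of_isAffineOpen (i ≫ f) (W.2.preimage i) ⟨genericPoint X, hξ⟩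
  -- dimension of `X'` through the non-empty affine open `X' ∩ W'`
  haveI : LocallyOfFiniteType ((R'.strictTransformPlus i.ker).subschemeι ≫ R'.πPlus ≫ f) := by
    change LocallyOfFiniteType ((R'.strictTransformPlus i.ker).subschemeι ≫ (R'.plus.ι ≫ R'.π) ≫ f)
    infer_instance
  have hV : IsAffineOpen ((R'.strictTransformPlus i.ker).subschemeι ⁻¹ᵁ (W' : R'.plus.toScheme.Opens)) :=
    W'.2.preimage _
  haveI : Nontrivial Γ((R'.strictTransformPlus i.ker).subscheme,
      (R'.strictTransformPlus i.ker).subschemeι ⁻¹ᵁ (W' : R'.plus.toScheme.Opens)) :=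
    eX'.symm.injective.nontrivial
  have hne : (((R'.strictTransformPlus i.ker).subschemeι ⁻¹ᵁ (W' : R'.plus.toScheme.Opens) :
      (R'.strictTransformPlus i.ker).subscheme.Opens) : Set (R'.strictTransformPlus i.ker).subscheme).Nonempty := by
    let x : PrimeSpectrum Γ((R'.strictTransformPlus i.ker).subscheme,
        (R'.strictTransformPlus i.ker).subschemeι ⁻¹ᵁ (W' : R'.plus.toScheme.Opens)) :=
      Classical.arbitrary _
    exact ⟨hV.fromSpec x, hV.range_fromSpec.le ⟨x, rfl⟩⟩
  have hdimX' : topologicalKrullDim ↥(R'.strictTransformPlus i.ker).subscheme =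
      ringKrullDim Γ((R'.strictTransformPlus i.ker).subscheme,
        (R'.strictTransformPlus i.ker).subschemeι ⁻¹ᵁ (W' : R'.plus.toScheme.Opens)) :=
    topologicalKrullDim_eq_ringKrullDim_of_isAffineOpen ((R'.strictTransformPlus i.ker).subschemeι ≫ R'.πPlus ≫ f)
      hV hne
  rw [hdimX', hdimX, ringKrullDim_eq_of_ringEquiv eX', ringKrullDim_laurentPolynomial,
    ringKrullDim_eq_of_ringEquiv e₄]

/-- **(D0) The strict transform has dimension `dim X + 1`** (res-type-017's signature): `i : X ⟶ Y` a closed immersion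
of an integral `X` into `Y` locally of finite type over a field, `R` a regular weighted centre with the generic point of
`X` off its support, `R'` a Rees filtration with the pieces of `R`; if the strict transform `X' = V(σˢ(ker i)|_{B₊})` on the
global cobordant blow-up is integral, then `dim X' = dim X + 1`. [cite: Wlodarczyk2022, 3.3.12]
[cite: GortzWedhorn2020, Thm. 5.22 (1)] -/
theorem topologicalKrullDim_strictTransformPlus (f : Y ⟶ Spec (.of k)) [LocallyOfFiniteType f]
    (i : X ⟶ Y) [IsClosedImmersion i] [IsIntegral X] (R : ReesAlgebraData Y) (hc : R.IsRegularWeightedCentre)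
    (hξ : i (genericPoint X) ∉ R.support) (R' : ReesFiltration Y) (hR' : R'.ideal = R.piece)
    [IsIntegral (R'.strictTransformPlus i.ker).subscheme] :
    topologicalKrullDim ↥(R'.strictTransformPlus i.ker).subscheme = topologicalKrullDim ↥X + 1 := by
  haveI : IsLocallyNoetherian Y := LocallyOfFiniteType.isLocallyNoetherian f
  haveI : LocallyOfFiniteType R'.π := WeightedThesis.GlobalCobordantPlus.locallyOfFiniteType_π R R' hR' hc
  -- some positive piece misses `i ξ`
  obtain ⟨n, hn, hξn⟩ : ∃ n : ℕ, 0 < n ∧ i (genericPoint X) ∉ (R.piece n).support := by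
    by_contra h
    push Not at h
    exact hξ (R.mem_support_iff.mpr h)
  -- an affine `W ∋ i ξ` inside the open complement of that support
  obtain ⟨_, ⟨W, hWaff, rfl⟩, hξW, hWle⟩ := Y.isBasis_affineOpens.exists_subset_of_mem_open
    (show i (genericPoint X) ∈ ((R.piece n).support : Set Y)ᶜ from hξn) (R.piece n).support.isClosed.isOpen_compl
  have hW : (R'.ideal n).ideal ⟨W, hWaff⟩ = ⊤ := by
    rw [hR']
    exact ideal_eq_top_of_forall_not_mem_support (R.piece n) ⟨W, hWaff⟩ fun y hy hmem => hWle hy hmem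
  exact topologicalKrullDim_strictTransformPlus_of_ideal_eq_top f i R' ⟨W, hWaff⟩ hn hW hξW

end Geometry

end Summit.ResolutionOfSingularities.ResolutionOfSingularities.Theorems.StrictTransformDimension

end
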